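import Summits.ResolutionOfSingularities.ResolutionOfSingularities.Theorems.SharpStrataSepExcModelsDefs
import Summits.ResolutionOfSingularities.ResolutionOfSingularities.Theorems.SharpStrataSepExcModelsRatAbhyankarModel
import Mathlib.AlgebraicGeometry.FunctionField
import HarnessLib

/-!
# A residually rational Abhyankar valuation centred at `ζ` makes `ζ` separably exceptional

Line `birth` of crux `SharpStrata.SepExcModels` (stmt-ResolutionOfSingularities-16828,
`Cruxes/SepExcModels/Lines/birth.lean`), lead c1, tool stub (T2, SCHEME form of the valuative
criterion) `stub_sepExcAt_of_ratAbhyankarPlace`, PROVED.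

Setting: `k` perfect, `Y` an integral scheme locally of finite type over `k`, `ζ ∈ Y`, and `O` a
valuation ring of the function field `K(Y)` containing the local ring `𝒪_{Y,ζ}`, dominating it
(`𝔪_ζ ⊆ 𝔪_O`), an ABHYANKAR place of `K(Y) | k` (`IsAbhyankarPlace`,
`Literature/…/ValuedFunctionFields.lean`; `k` embedded through `k = Γ(Spec k) → Γ(Y, ⊤) → K(Y)`)
and RESIDUALLY RATIONAL over `𝒪_{Y,ζ}` (every element of `O` is congruent to a germ at `ζ` modulo
`𝔪_O`). Conclusion: `SepExcAt Y ζ` (`Theorems/SharpStrataSepExcModelsDefs.lean`), by its third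
disjunct — a finitely generated birational local model `B = 𝒪_{Y,ζ}[s] ⊆ K(Y)` with a prime `𝔮`
over `𝔪_ζ`, `B_𝔮` regular and `(B/𝔮)[1/g]` smooth over `κ(ζ)`.

## Proof

Scheme dress of the ring form `RatAbhyankarModel.stub_model_of_ratAbhyankarPlace`
(`Theorems/SharpStrataSepExcModelsRatAbhyankarModel.lean`; Knaf–Kuhlmann 2005, Thm. 1.1): choose an
affine open `V = Spec A ∋ ζ`; `A = Γ(Y, V)` is a finitely generated `k`-algebra
(`HasRingHomProperty.appLE` for `LocallyOfFiniteType`), `K(Y) = Frac A`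
(Mathlib `functionField_isFractionRing_of_isAffineOpen`), `𝒪_{Y,ζ} = A_P` inside `K(Y)` for the
prime `P` of `ζ` (Mathlib `IsAffineOpen.isLocalization_stalk`, `functionField_isScalarTower`), and
`K(Y) / k` is finitely generated as a field (`IntermediateField.fg_top_iff`: it is essentially of
finite type, being a localisation of the finitely generated `A`). The ring form then produces the
third disjunct of `SepExcAt Y ζ` verbatim.

## Sources

* H. Knaf, F.-V. Kuhlmann, *Abhyankar places admit local uniformization in any characteristic*,
  Ann. Sci. ÉNS 38 (2005) 833–846, Thm. 1.1. [KnafKuhlmann2005]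
* A. Benito, O. Piltant, A. J. Reguera, *Small irreducible components of arc spaces in positive
  characteristic*, J. Pure Appl. Algebra 226 (2022) 107113, Question 6.6. [BenitoPiltantReguera2022]
-/

noncomputable section

-- single-problem summit: the doubled namespace component `ResolutionOfSingularities` is forced
set_option linter.dupNamespace false

open CategoryTheory AlgebraicGeometry TopologicalSpace
open Literature.AlgebraicGeometry.Resolution IsLocalRing
open Summit.ResolutionOfSingularities.ResolutionOfSingularities.Theorems.SepExcModels

namespace Summit.ResolutionOfSingularities.ResolutionOfSingularities.Theorems.SepExcModels.RatAbhyankarPoint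

/-- **A residually rational Abhyankar valuation centred at `ζ` makes `ζ` separably exceptional**
(registered tool stub T2, scheme form, of line `birth` of crux `SepExcModels`). For an integral
`Y` locally of finite type over a perfect field `k`, `ζ ∈ Y`, and a valuation ring `O` of `K(Y)`
containing `𝒪_{Y,ζ}`, dominating it, Abhyankar over `k` (w.r.t. `k → Γ(Spec k) → Γ(Y,⊤) → K(Y)`)
and residually rational over `𝒪_{Y,ζ}`: `SepExcAt Y ζ`. Scheme dress of
`RatAbhyankarModel.stub_model_of_ratAbhyankarPlace` (affine chart `Spec A ∋ ζ`,
`𝒪_{Y,ζ} = A_P` inside `K(Y)` by `IsAffineOpen.isLocalization_stalk`, `K(Y) = Frac A` by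
`functionField_isFractionRing_of_isAffineOpen`, `K(Y)/k` finitely generated by
`IntermediateField.fg_top_iff`). [cite: KnafKuhlmann2005, Thm. 1.1] -/
theorem stub_sepExcAt_of_ratAbhyankarPlace (k : Type) [Field k] [PerfectField k]
    (Y : Scheme.{0}) [IsIntegral Y] (f : Y ⟶ Spec (.of k)) [LocallyOfFiniteType f] (ζ : Y)
    (O : ValuationSubring Y.functionField)
    (hRO : ∀ r : Y.presheaf.stalk ζ, algebraMap (Y.presheaf.stalk ζ) Y.functionField r ∈ O)
    (hdom : ∀ r ∈ IsLocalRing.maximalIdeal (Y.presheaf.stalk ζ),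
      O.valuation (algebraMap (Y.presheaf.stalk ζ) Y.functionField r) < 1)
    (hAbh : IsAbhyankarPlace O
      ((Y.presheaf.germ ⊤ (genericPoint Y) trivial).hom.comp
        (f.appTop.hom.comp (Scheme.ΓSpecIso (.of k)).inv.hom)).fieldRange ⊤)
    (hrat : ∀ x ∈ O, ∃ r : Y.presheaf.stalk ζ,
      O.valuation (algebraMap (Y.presheaf.stalk ζ) Y.functionField r - x) < 1) :
    SepExcAt Y ζ := by
  classical
  -- the `k`-algebra structure on `K(Y)`: `k = Γ(Spec k) → Γ(Y, ⊤) → K(Y)`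
  let ι : k →+* Γ(Spec (CommRingCat.of k), ⊤) := (Scheme.ΓSpecIso (CommRingCat.of k)).inv.hom
  letI algK : Algebra k Y.functionField :=
    ((Y.presheaf.germ ⊤ (genericPoint Y) trivial).hom.comp (f.appTop.hom.comp ι)).toAlgebra
  -- an affine open neighbourhood `V = Spec A` of `ζ`; `A` is of finite type over `k`
  obtain ⟨V, hV, hζV, -⟩ := exists_isAffineOpen_mem_and_subset (X := Y) (x := ζ) (U := ⊤) trivial
  haveI : Nonempty V := ⟨⟨ζ, hζV⟩⟩
  have hηV : genericPoint Y ∈ V :=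
    ((genericPoint_spec Y).mem_open_set_iff V.isOpen).mpr (by simpa using ‹Nonempty V›)
  have hφ : RingHom.FiniteType (f.appLE ⊤ V le_top).hom :=
    HasRingHomProperty.appLE @LocallyOfFiniteType f ‹_› ⟨⊤, isAffineOpen_top _⟩ ⟨V, hV⟩ le_top
  have hψ : RingHom.FiniteType ((f.appLE ⊤ V le_top).hom.comp ι) :=
    hφ.comp (RingHom.FiniteType.of_surjective _
      (Scheme.ΓSpecIso (CommRingCat.of k)).symm.commRingCatIsoToRingEquiv.surjective)
  letI algV : Algebra k Γ(Y, V) := ((f.appLE ⊤ V le_top).hom.comp ι).toAlgebra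
  haveI : Algebra.FiniteType k Γ(Y, V) := hψ
  -- the stalk at `ζ` is the localisation of `A` at the prime of `ζ`, inside `K(Y) = Frac A`
  letI := TopCat.Presheaf.algebra_section_stalk Y.presheaf (⟨ζ, hζV⟩ : V)
  haveI := functionField_isScalarTower Y V ⟨ζ, hζV⟩
  haveI := hV.isLocalization_stalk ⟨ζ, hζV⟩
  haveI : IsFractionRing Γ(Y, V) Y.functionField :=
    functionField_isFractionRing_of_isAffineOpen Y V hV
  -- `k → A → K(Y)` is the structure map of `K(Y)`
  haveI : IsScalarTower k Γ(Y, V) Y.functionField := by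
    refine IsScalarTower.of_algebraMap_eq fun c => ?_
    change (Y.presheaf.germ ⊤ (genericPoint Y) trivial) (f.appTop (ι c)) =
      Y.germToFunctionField V ((f.app ⊤ ≫ Y.presheaf.map (homOfLE le_top).op) (ι c))
    have hres := TopCat.Presheaf.germ_res Y.presheaf (homOfLE (le_top : V ≤ ⊤)) (genericPoint Y)
      hηV
    rw [Scheme.germToFunctionField, ← hres]
    rfl
  -- `K(Y) / k` is finitely generated as a field
  haveI : Algebra.EssFiniteType Γ(Y, V) Y.functionField :=
    Algebra.EssFiniteType.of_isLocalization _ (nonZeroDivisors Γ(Y, V))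
  haveI : Algebra.EssFiniteType k Y.functionField :=
    Algebra.EssFiniteType.comp k Γ(Y, V) Y.functionField
  have hfg : (⊤ : IntermediateField k Y.functionField).FG :=
    IntermediateField.fg_top_iff.mpr inferInstance
  -- the ring form, at `R = 𝒪_{Y,ζ} = A_P`, is the third disjunct verbatim
  exact Or.inr (Or.inr (RatAbhyankarModel.stub_model_of_ratAbhyankarPlace
    (hV.primeIdealOf ⟨ζ, hζV⟩).asIdeal hfg O hRO hdom hAbh hrat))

end Summit.ResolutionOfSingularities.ResolutionOfSingularities.Theorems.SepExcModels.RatAbhyankarPoint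

end
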